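import Mathlib
import Summits.Ventures.PercRepro.TriangleCapFourRowThreeLocusPieces

/-!
# PercRepro — THE SECOND-ORDER LOCUS ON THE CELL `(k, 4, 3)`: every non-`4`-bipartite `K₄⁻`-free graph with
`4 (k − 4) − 3` edges on `k ≥ 11` vertices at the non-bipartite second-best value `m k − 3 (k − 4) − (2k − 18)` is
`K_{5,k−5}` minus a `(k − 6)`-star (p3, gen 46; part 199m)

Part 199d's induction tracked at equality: the cap is strict (part 199k), the convexity is strict; a vertex `z` of
degree `d ≤ 4` is deleted — `d = 0` is `K_{5,5}` plus an isolated vertex at `k = 11` (`5`-bipartite) and strict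
beyond; `d = 1` is `K_{4,k−5}` with the neighbour of `z` on the large side (`5`-bipartite) or strict; `d = 2, 3`:
`D − z` `4`-bipartite with the neighbours of `z` all off its `4`-side (`5`-bipartite), the mixtures and the
non-bipartite branch strict; `d = 4`: at the corner `k = 11` the third order on `(10, 21)` — `K_{3,7}` (`D` is
`4`-bipartite), `4`-bipartite (all off: `5`-bipartite; mixed: strict by the `K₄⁻` refinement), or exactly `190` with
the four neighbours of degree `5`, part 199l's exact read of the third-order locus — and for `k ≥ 12` the
induction hypothesis: `D − z` is `K_{5,k−6}` minus a `(k − 7)`-star and the four neighbours of `z`, of degree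
`k − 6 > 5`, lie on its `5`-side. The census (kit j315861): `15,246` maximisers at `(11, 25)`, all `5`-bipartite.
`four_three_nonbip_second_best_maximisers`: on `Fin k`, non-`4`-bipartite, `Σ_v d(v)² + 3 (k − 4) + (2k − 18) = m k
↔ ∃ A v, |A| = 5 ∧ BipSub D A ∧ MissingStar D A v`. Axioms: standard.
-/

namespace PercRepro

namespace TriangleCap

namespace C047

open Finset

universe u

variable {V : Type*} [Fintype V] [DecidableEq V]

/-- **THE SECOND-ORDER LOCUS ON `(k, 4, 3)`, BY INDUCTION ON `k`:** `K₄⁻`-free, `m + 3 = 4 (k − 4)`, `11 ≤ k`, not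
`4`-bipartite, `Σ_v d(v)² + 3 (k − 4) + (2k − 18) = m k` ⇒ `D` is a spanning subgraph of some `K(A, Aᶜ)`, `|A| = 5`. -/
theorem four_three_second_locus_aux (n : ℕ) :
    ∀ (W : Type u) [Fintype W] [DecidableEq W] (D : SimpleGraph W) [DecidableRel D.Adj], Fintype.card W = n →
      K4mFree D → 11 ≤ Fintype.card W → D.edgeFinset.card + 3 = 4 * (Fintype.card W - 4) →
      ¬ (∃ A : Finset W, A.card = 4 ∧ BipSub D A) →
      ∑ v, deg D v * deg D v + 3 * (Fintype.card W - 4) + (2 * Fintype.card W - 18) =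
        D.edgeFinset.card * Fintype.card W →
      ∃ A : Finset W, A.card = 5 ∧ BipSub D A := by
  refine Nat.strong_induction_on n ?_
  intro n ih W _ _ D _ hn hK hk hm hnb heq
  -- (A) the cap is strict
  by_cases hx : ∃ x, deg D x + 4 = Fintype.card W
  · obtain ⟨x, hx⟩ := hx
    rcases four_three_cap_strict D hK hk hm x hx with h | h
    · exact absurd h hnb
    · omega
  push Not at hx
  have hcap : ∀ v, deg D v + 4 ≤ Fintype.card W := fun v =>
    deg_add_le_card_of_dense D hK 4 (by norm_num) (by omega)
      (cap_arith 4 (Fintype.card W) D.edgeFinset.card 3 (by norm_num) (by omega) (by omega)) v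
  have hcap' : ∀ v, deg D v + 5 ≤ Fintype.card W := fun v => by
    have h1 := hcap v
    have h2 := hx v
    omega
  have hcap6 : ∀ v, deg D v ≤ (Fintype.card W - 6) + 1 := fun v => by have := hcap' v; omega
  -- (B) the convexity is strict
  by_cases hdeg : ∀ v, 5 ≤ deg D v
  · exfalso
    have h := below_convex_gen D 4 3 (by norm_num) (by omega) hm hcap' hdeg
    have h2 : 3 * (Fintype.card W - 2 * 4 - 1) ≤ Fintype.card W * (Fintype.card W - 2 * 4 - 1) :=
      Nat.mul_le_mul_right _ (by omega)
    omega
  push Not at hdeg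
  obtain ⟨z, hz⟩ := hdeg
  -- the deletion bookkeeping
  have hK' := k4mFree_del D hK z
  have hcard' := card_del z
  have hedges' := card_edges_del D z
  have hsq := sum_deg_sq_del D z
  have hT := sum_del_nbhd_le D z (Fintype.card W - 6) hcap6
  have hNz := card_nbhd_del D z
  obtain ⟨T, hTdef⟩ : ∃ T, ∑ a : {v : W // v ≠ z}, (if D.Adj a.1 z then deg (del D z) a else 0) = T := ⟨_, rfl⟩
  obtain ⟨S', hS'def⟩ : ∃ S', ∑ a : {v : W // v ≠ z}, deg (del D z) a * deg (del D z) a = S' := ⟨_, rfl⟩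
  obtain ⟨m', hm'def⟩ : ∃ m', (del D z).edgeFinset.card = m' := ⟨_, rfl⟩
  obtain ⟨Nz, hNzdef⟩ : ∃ Nz : Finset {v : W // v ≠ z},
      Nz = univ.filter (fun a : {v : W // v ≠ z} => D.Adj a.1 z) := ⟨_, rfl⟩
  have hmemNz : ∀ a : {v : W // v ≠ z}, a ∈ Nz ↔ D.Adj a.1 z := fun a => by
    rw [hNzdef, mem_filter]
    simp only [mem_univ, true_and]
  have hTfilt : T = ∑ a ∈ Nz, deg (del D z) a := by rw [← hTdef, hNzdef, sum_filter]
  rw [← hNzdef] at hNz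
  rw [hTdef, hS'def] at hsq
  rw [hTdef] at hT
  rw [hm'def] at hedges'
  obtain ⟨s, hs⟩ : ∃ s, Fintype.card W = s + 11 := ⟨Fintype.card W - 11, by omega⟩
  have hcardW' : Fintype.card {v : W // v ≠ z} = s + 10 := by omega
  have hdegNz : ∀ a ∈ Nz, deg (del D z) a ≤ Fintype.card W - 6 := fun a ha => by
    have h := deg_del D z a
    rw [if_pos ((hmemNz a).mp ha)] at h
    have := hcap6 a.1
    omega
  -- the mixed count for a `4`-bipartite `D − z`
  have hmixedT : ∀ A' : Finset {v : W // v ≠ z}, A'.card = 4 → BipSub (del D z) A' →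
      (∃ w₀ : {v : W // v ≠ z}, D.Adj w₀.1 z ∧ w₀ ∉ A') →
      T + (Fintype.card W - 6) ≤ deg D z * (Fintype.card W - 6) + 4 := by
    intro A' hA'card hB hw
    obtain ⟨w₀, hw₀z, hw₀A⟩ := hw
    have hdw₀ : deg (del D z) w₀ ≤ 4 := by
      have := deg_le_card_of_bipSub (del D z) A' hB w₀ hw₀A
      rw [hA'card] at this
      exact this
    rw [hTfilt, ← hNz]
    exact sum_le_of_mem_le Nz (fun a => deg (del D z) a) (Fintype.card W - 6) ((hmemNz w₀).mpr hw₀z) hdegNz hdw₀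
  -- the three-way split for a `4`-bipartite `D − z`: `4`-bipartite (excluded), `5`-bipartite, or mixed
  have hsides : ∀ A' : Finset {v : W // v ≠ z}, A'.card = 4 → BipSub (del D z) A' →
      (∃ A : Finset W, A.card = 5 ∧ BipSub D A) ∨
        (∃ w₀ : {v : W // v ≠ z}, D.Adj w₀.1 z ∧ w₀ ∉ A') ∧ (∃ a : {v : W // v ≠ z}, D.Adj a.1 z ∧ a ∈ A') := by
    intro A' hA'card hB
    by_cases hall : ∀ a : {v : W // v ≠ z}, D.Adj a.1 z → a ∈ A'
    · obtain ⟨B, hBcard, hBsub⟩ := bipSub_lift D z A' hB hall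
      exact absurd ⟨B, by rw [hBcard, hA'card], hBsub⟩ hnb
    by_cases hnone : ∀ a : {v : W // v ≠ z}, D.Adj a.1 z → a ∉ A'
    · obtain ⟨A, hAcard, hAsub⟩ := bipSub_insert_of_nbhd_off D z A' hB hnone
      exact Or.inl ⟨A, by rw [hAcard, hA'card], hAsub⟩
    · push Not at hall hnone
      exact Or.inr ⟨hall, hnone⟩
  rw [hsq] at heq
  have hd : deg D z = 0 ∨ deg D z = 1 ∨ deg D z = 2 ∨ deg D z = 3 ∨ deg D z = 4 := by omega
  rcases hd with hd0 | hd1 | hd2 | hd3 | hd4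
  · -- `d = 0`
    have hm'0 : m' = 4 * s + 25 := by omega
    rcases Nat.eq_zero_or_pos s with hs0 | hspos
    · -- `k = 11`: `D − z = K_{5,5}`, `D` is `5`-bipartite
      subst hs0
      have hcard10 : Fintype.card {v : W // v ≠ z} = 10 := by omega
      obtain ⟨A', hA'card, hiff⟩ := k4mFree_extremal_complete (del D z) hK' (by omega)
        (by rw [hm'def, hcard10, hm'0])
      rw [hcard10] at hA'card
      have hB : BipSub (del D z) A' := fun x y h => ((hiff x y).mp h).1
      obtain ⟨B, hBcard, hBsub⟩ := bipSub_lift D z A' hB (fun a ha => by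
        have : a ∈ Nz := (hmemNz a).mpr ha
        rw [hd0] at hNz
        rw [card_eq_zero] at hNz
        rw [hNz] at this
        exact absurd this (notMem_empty a))
      exact ⟨B, by rw [hBcard, hA'card], hBsub⟩
    · exfalso
      have h := closed_form_stability (del D z) hK' 5 (s + 11 - 11) (by norm_num) (by rw [hcardW']; omega)
        (by rw [hm'def, hcardW', hm'0]; omega)
      rw [hS'def, hm'def, hcardW'] at h
      have e : s + 10 - 1 - (s + 11 - 11) = 9 := by omega
      rw [e] at h
      rw [hd0, hs] at hT
      rw [← hedges', hs, hd0] at heq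
      exact four_three_del_zero_false s m' S' T hspos hm'0 h hT heq
  · -- `d = 1`
    have hm'1 : m' = 4 * s + 24 := by omega
    rcases diag_second_order_gen (del D z) hK' 4 (le_refl 4) (by omega) (by rw [hm'def, hcardW', hm'1]; omega)
      with ⟨A', hA'card, hB⟩ | hgap
    · rcases hsides A' hA'card hB with h | ⟨⟨w₀, hw₀z, hw₀A⟩, ⟨a, haz, haA⟩⟩
      · exact h
      · -- two distinct neighbours of a vertex of degree `1`: impossible
        exfalso
        have hne : w₀ ≠ a := fun h => hw₀A (h ▸ haA)
        have hsub : ({w₀, a} : Finset {v : W // v ≠ z}) ⊆ Nz := by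
          intro t ht
          rw [mem_insert, mem_singleton] at ht
          rcases ht with rfl | rfl
          · exact (hmemNz _).mpr hw₀z
          · exact (hmemNz _).mpr haz
        have := card_le_card hsub
        rw [card_pair hne, hNz, hd1] at this
        omega
    · exfalso
      rw [hS'def, hm'def, hcardW'] at hgap
      rw [hd1, hs] at hT
      rw [← hedges', hs, hd1] at heq
      exact four_three_del_one_gap_false s m' S' T hm'1 hgap hT heq
  · -- `d = 2`
    have hm'2 : m' = 4 * s + 23 := by omega
    rcases one_below_second_order_gen (del D z) hK' 4 (le_refl 4) (by omega)
      (by rw [hm'def, hcardW', hm'2]; omega) with ⟨A', hA'card, hB⟩ | hgap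
    · rcases hsides A' hA'card hB with h | ⟨hw, -⟩
      · exact h
      · exfalso
        have hT' := hmixedT A' hA'card hB hw
        have hS := sum_deg_sq_le_of_bipSub (del D z) A' hB 4 1 hA'card (by rw [hm'def, hcardW', hm'2]; omega)
          (by omega)
        rw [hS'def, hm'def, hcardW'] at hS
        rw [hs, hd2] at hT'
        rw [← hedges', hs, hd2] at heq
        exact four_three_del_two_mixed_false s m' S' T hm'2 hS hT' heq
    · exfalso
      rw [hS'def, hm'def, hcardW'] at hgap
      rw [hd2, hs] at hT
      rw [← hedges', hs, hd2] at heq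
      exact four_three_del_two_gap_false s m' S' T hm'2 hgap hT heq
  · -- `d = 3`
    have hm'3 : m' = 4 * s + 22 := by omega
    rcases four_two_second_order (del D z) hK' (by omega) (by rw [hm'def, hcardW', hm'3]; omega)
      with ⟨A', hA'card, hB⟩ | hgap
    · rcases hsides A' hA'card hB with h | ⟨hw, -⟩
      · exact h
      · exfalso
        have hT' := hmixedT A' hA'card hB hw
        have hS := sum_deg_sq_le_of_bipSub (del D z) A' hB 4 2 hA'card (by rw [hm'def, hcardW', hm'3]; omega)
          (by omega)
        rw [hS'def, hm'def, hcardW'] at hS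
        rw [hs, hd3] at hT'
        rw [← hedges', hs, hd3] at heq
        exact four_three_del_three_mixed_false s m' S' T hm'3 hS hT' heq
    · exfalso
      rw [hS'def, hm'def, hcardW'] at hgap
      rw [hd3, hs] at hT
      rw [← hedges', hs, hd3] at heq
      exact four_three_del_three_gap_false s m' S' T hm'3 hgap hT heq
  · -- `d = 4`
    have hm'4 : m' = 4 * s + 21 := by omega
    -- the strict mixed count
    have hmixed4 : ∀ A' : Finset {v : W // v ≠ z}, A'.card = 4 → BipSub (del D z) A' →
        (∃ a : {v : W // v ≠ z}, D.Adj a.1 z ∧ a ∈ A') → (∃ w₀ : {v : W // v ≠ z}, D.Adj w₀.1 z ∧ w₀ ∉ A') →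
        T ≤ 3 * (Fintype.card W - 6) + 2 := by
      intro A' hA'card hB hin hout
      rw [← hTdef]
      exact four_three_mixed_T_strict D hK hk z hd4 A' hA'card hB hcap6 hin hout
    rcases Nat.eq_zero_or_pos s with hs0 | hspos
    · -- the corner `k = 11`
      subst hs0
      have hk11 : Fintype.card W = 11 := by omega
      have hcard10 : Fintype.card {v : W // v ≠ z} = 10 := by omega
      have hm'21 : m' = 21 := by omega
      by_cases h3' : ∃ A' : Finset {v : W // v ≠ z}, A'.card = 3 ∧ BipSub (del D z) A'
      · -- `D − z = K_{3,7}`: `D` is `4`-bipartite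
        exfalso
        obtain ⟨A', hA'card, hA'⟩ := h3'
        have hfull : ∀ {x y : {v : W // v ≠ z}}, x ∈ A' → y ∉ A' → (del D z).Adj x y := fun hx hy =>
          adj_of_bipSub_full (del D z) A' hA' 3 hA'card (by rw [hm'def, hcard10, hm'21]) hx hy
        have hall : ¬ ∀ a : {v : W // v ≠ z}, D.Adj a.1 z → a ∈ A' := by
          intro hall
          have hsub : Nz ⊆ A' := fun a ha => hall a ((hmemNz a).mp ha)
          have := card_le_card hsub
          omega
        push Not at hall
        obtain ⟨a₀, ha₀z, ha₀A⟩ := hall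
        have hoff : ∀ a : {v : W // v ≠ z}, D.Adj a.1 z → a ∉ A' := by
          intro a₁ ha₁z ha₁A
          have hne01 : a₀ ≠ a₁ := fun h => ha₀A (h ▸ ha₁A)
          obtain ⟨a₂, ha₂z, ha₂0, ha₂1⟩ : ∃ a₂ : {v : W // v ≠ z}, D.Adj a₂.1 z ∧ a₂ ≠ a₀ ∧ a₂ ≠ a₁ := by
            have h2 : 2 < Nz.card := by omega
            obtain ⟨b₁, hb₁, b₂, hb₂, b₃, hb₃, h12, h13, h23⟩ := two_lt_card.mp h2
            rw [hmemNz] at hb₁ hb₂ hb₃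
            by_cases e1 : b₁ = a₀ ∨ b₁ = a₁
            · by_cases e2 : b₂ = a₀ ∨ b₂ = a₁
              · refine ⟨b₃, hb₃, ?_, ?_⟩
                · intro h; rcases e1 with rfl | rfl <;> rcases e2 with rfl | rfl <;>
                    first | exact h12 rfl | exact h13 h | exact h13 h.symm | exact h23 h | exact h23 h.symm
                · intro h; rcases e1 with rfl | rfl <;> rcases e2 with rfl | rfl <;>
                    first | exact h12 rfl | exact h13 h | exact h13 h.symm | exact h23 h | exact h23 h.symm
              · push Not at e2
                exact ⟨b₂, hb₂, e2.1, e2.2⟩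
            · push Not at e1
              exact ⟨b₁, hb₁, e1.1, e1.2⟩
          have h10 : D.Adj a₁.1 a₀.1 := (del_adj D z a₁ a₀).mp (hfull ha₁A ha₀A)
          by_cases ha₂A : a₂ ∈ A'
          · have h20 : D.Adj a₂.1 a₀.1 := (del_adj D z a₂ a₀).mp (hfull ha₂A ha₀A)
            exact not_adj_both D hK (D.adj_symm ha₀z) (D.adj_symm ha₁z) (D.adj_symm h10)
              (fun h => ha₂1 (Subtype.ext h).symm) (D.adj_symm ha₂z) (D.adj_symm h20)
          · have h12' : D.Adj a₁.1 a₂.1 := (del_adj D z a₁ a₂).mp (hfull ha₁A ha₂A)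
            exact not_adj_both D hK (D.adj_symm ha₁z) (D.adj_symm ha₀z) h10
              (fun h => ha₂0 (Subtype.ext h).symm) (D.adj_symm ha₂z) h12'
        obtain ⟨B, hBcard, hB⟩ := bipSub_insert_of_nbhd_off D z A' hA' hoff
        exact hnb ⟨B, by rw [hBcard, hA'card], hB⟩
      by_cases h4' : ∃ A' : Finset {v : W // v ≠ z}, A'.card = 4 ∧ BipSub (del D z) A'
      · obtain ⟨A', hA'card, hB⟩ := h4'
        rcases hsides A' hA'card hB with h | ⟨hw, ha⟩
        · exact h
        · exfalso
          have hT' := hmixed4 A' hA'card hB ha hw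
          have hS := sum_deg_sq_le_of_bipSub (del D z) A' hB 4 3 hA'card (by rw [hm'def, hcard10, hm'21])
            (by omega)
          rw [hS'def, hm'def, hcard10, hm'21] at hS
          rw [hk11] at hT'
          rw [← hedges', hk11, hd4, hm'21] at heq
          omega
      · -- neither: the third order on `(10, 21)` at `190`, all four neighbours of degree `5`
        have hthird : ∑ a : {v : W // v ≠ z}, deg (del D z) a * deg (del D z) a + 20 ≤
            (del D z).edgeFinset.card * Fintype.card {v : W // v ≠ z} := by
          rcases three_diag_third_order_ten (del D z) hK' hcard10 (by rw [hm'def, hm'21]) with h | h | h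
          · exact absurd h h3'
          · exact absurd h h4'
          · exact h
        rw [hS'def, hm'def, hcard10, hm'21] at hthird
        rw [hd4, hk11] at hT
        rw [← hedges', hk11, hd4, hm'21] at heq
        have hS190 : S' = 190 := by omega
        have hT20 : T = 20 := by omega
        have h5 := eq_of_sum_eq_card_mul Nz (fun a => deg (del D z) a) 5
          (fun a ha => by have := hdegNz a ha; rw [hk11] at this; exact this) (by rw [← hTfilt, hT20, hNz, hd4])
        exact four_three_corner_third_exact D hK hk11 z hd4 h3' h4' (by rw [hm'def, hm'21])
          (by rw [hS'def, hm'def, hcard10, hm'21, hS190]) (fun a ha => h5 a ((hmemNz a).mpr ha))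
    · -- `k ≥ 12`: the induction hypothesis
      by_cases hb4 : ∃ A' : Finset {v : W // v ≠ z}, A'.card = 4 ∧ BipSub (del D z) A'
      · obtain ⟨A', hA'card, hB⟩ := hb4
        rcases hsides A' hA'card hB with h | ⟨hw, ha⟩
        · exact h
        · exfalso
          have hT' := hmixed4 A' hA'card hB ha hw
          have hS := sum_deg_sq_le_of_bipSub (del D z) A' hB 4 3 hA'card (by rw [hm'def, hcardW', hm'4]; omega)
            (by omega)
          rw [hS'def, hm'def, hcardW'] at hS
          rw [hs] at hT'
          rw [← hedges', hs, hd4] at heq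
          exact four_three_del_four_mixed_false s m' S' T hm'4 hS hT' heq
      · have hgap : S' + 3 * (s + 10 - 4) + (2 * (s + 10) - 18) ≤ m' * (s + 10) := by
          rcases four_three_second_order (del D z) hK' (by omega) (by rw [hm'def, hcardW', hm'4]; omega)
            with h | h
          · exact absurd h hb4
          · rw [hS'def, hm'def, hcardW'] at h
            exact h
        rw [hd4, hs] at hT
        rw [← hedges', hs, hd4] at heq
        obtain ⟨hS'eq, hTeq⟩ := four_three_del_four_eq s m' S' T hm'4 hgap hT heq
        obtain ⟨A'', hA''card, hB''⟩ := ih (Fintype.card {v : W // v ≠ z}) (by omega) {v : W // v ≠ z} (del D z)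
          rfl hK' (by omega) (by rw [hm'def, hcardW', hm'4]; omega) hb4
          (by rw [hS'def, hm'def, hcardW']; exact hS'eq)
        -- the four neighbours of `z` have degree `k − 6 > 5` in `D − z`: all on the `5`-side
        have h5 := eq_of_sum_eq_card_mul Nz (fun a => deg (del D z) a) (Fintype.card W - 6) hdegNz
          (by rw [← hTfilt, hNz, hd4, hs]; exact hTeq)
        have hall : ∀ a : {v : W // v ≠ z}, D.Adj a.1 z → a ∈ A'' := by
          intro a ha
          by_contra hA
          have h1 := deg_le_card_of_bipSub (del D z) A'' hB'' a hA
          have h2 : deg (del D z) a = Fintype.card W - 6 := h5 a ((hmemNz a).mpr ha)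
          rw [hA''card] at h1
          omega
        obtain ⟨B, hBcard, hBsub⟩ := bipSub_lift D z A'' hB'' hall
        exact ⟨B, by rw [hBcard, hA''card], hBsub⟩

/-- **THE SECOND-ORDER LOCUS ON `(k, 4, 3)`:** `K₄⁻`-free, `m + 3 = 4 (k − 4)`, `11 ≤ k`, not `4`-bipartite, at the
non-bipartite second-best value ⇒ `D` is a spanning subgraph of some `K(A, Aᶜ)` with `|A| = 5`. -/
theorem four_three_second_locus (D : SimpleGraph V) [DecidableRel D.Adj] (hK : K4mFree D)
    (hk : 11 ≤ Fintype.card V) (hm : D.edgeFinset.card + 3 = 4 * (Fintype.card V - 4))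
    (hnb : ¬ ∃ A : Finset V, A.card = 4 ∧ BipSub D A)
    (heq : ∑ v, deg D v * deg D v + 3 * (Fintype.card V - 4) + (2 * Fintype.card V - 18) =
      D.edgeFinset.card * Fintype.card V) :
    ∃ A : Finset V, A.card = 5 ∧ BipSub D A :=
  four_three_second_locus_aux (Fintype.card V) V D rfl hK hk hm hnb heq

/-- **THE NON-BIPARTITE SECOND-BEST MAXIMISERS ON `(k, 4, 3)`:** on `Fin k` (`11 ≤ k`), a non-`4`-bipartite
`K₄⁻`-free graph with `4 (k − 4) − 3` edges attains `Σ_v d(v)² + 3 (k − 4) + (2k − 18) = m k` iff it is `K_{5,k−5}`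
minus a `(k − 6)`-star (`5`-bipartite with a missing star). -/
theorem four_three_nonbip_second_best_maximisers (k : ℕ) (hk : 11 ≤ k) (D : SimpleGraph (Fin k))
    [DecidableRel D.Adj] (hK : K4mFree D) (hm : D.edgeFinset.card + 3 = 4 * (k - 4))
    (hnb : ¬ ∃ A : Finset (Fin k), A.card = 4 ∧ BipSub D A) :
    ∑ v, deg D v * deg D v + 3 * (k - 4) + (2 * k - 18) = D.edgeFinset.card * k ↔
      ∃ (A : Finset (Fin k)) (v : Fin k), A.card = 5 ∧ BipSub D A ∧ MissingStar D A v := by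
  have hcard : Fintype.card (Fin k) = k := Fintype.card_fin k
  constructor
  · intro heq
    obtain ⟨A, hAcard, hB⟩ := four_three_second_locus D hK (by omega) (by rw [hcard]; exact hm) hnb
      (by rw [hcard]; exact heq)
    obtain ⟨v, hv⟩ := exists_missingStar_of_closed_form_eq D A hB 5 (k - 6) hAcard (by rw [hcard]; omega)
      (by omega) (by
        rw [hcard]
        have e : k - 1 - (k - 6) = 5 := by omega
        rw [e]
        omega)
    exact ⟨A, v, hAcard, hB, hv⟩
  · rintro ⟨A, v, hAcard, hB, hv⟩
    have h := closed_form_eq_of_missingStar D A hB hv 5 (k - 6) hAcard (by rw [hcard]; omega) (by omega)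
    rw [hcard] at h
    have e : k - 1 - (k - 6) = 5 := by omega
    rw [e] at h
    omega

end C047

end TriangleCap

end PercRepro
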